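import Literature.Probability.Percolation.QuadCrossingRotationCouplingFiniteQuads
import Mathlib.Probability.ConditionalProbability
import HarnessLib

/-!
# DKKMO Thm. 1.2 (`d_SS` half, `q = 1`, plane): reduction to the finite-dimensional crossing laws

Topic `Probability/Percolation`; second proofs file next to `QuadCrossingRotationCoupling.lean` (the
named fact `dkkmo_theorem_1_2_schrammSmirnov`: Duminil-Copin–Kozlowski–Krachun–Manolescu–Oulamara,
arXiv:2012.11672v1, Theorem 1.2, Schramm–Smirnov half, `q = 1`, `Ω = ℝ²`) and
`QuadCrossingRotationCouplingFiniteQuads.lean` (the fact ⟺ (F) "couplings agreeing on finitely many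
quads", granted Schramm–Smirnov's Lemma 5.1).

Here (F) is identified with the statement about crossing PROBABILITIES it is really about:

* (J) *asymptotic rotation invariance of the finite-dimensional laws of the crossing field*: for
  every finite family `F ⊆ 𝒬_ℂ` and `ε > 0` there is `δ₀ > 0` such that for `α ∈ (ε, π - ε)`,
  `0 < δ ≤ δ₀` and every `G ⊆ F`,
  `|P_{1/2}[∀ Q ∈ F, (Q ∈ S_{ω_δ} ↔ Q ∈ G)] - P_{1/2}[∀ Q ∈ F, (Q ∈ e^{iα}·S_{ω_δ} ↔ Q ∈ G)]| ≤ ε`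
  (the joint law of the crossing indicators of `F` on `δℤ²` and on `e^{iα}δℤ²` are `ε`-close, atom
  by atom).

* `exists_coupling_of_finite_range` — the measure-theoretic tool (a maximal-type coupling): two
  probability spaces with random variables `X`, `Y` taking values in a finite set `s` can be coupled
  so that `ℙ[X ≠ Y] ≤ Σ_{a ∈ s} |P[X = a] - P'[Y = a]|` (weights
  `w(a,b) = min(p_a,q_a) 𝟙_{a=b} + (p_a - m_a)(q_b - m_b)/r`, conditional product measures on the
  fibres). [folklore; e.g. Lindvall, *Lectures on the coupling method*, §I.5]
* `finiteQuads_of_jointCrossingLaws` — (J) ⟹ (F) (apply the tool to the crossing patterns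
  `X = {Q ∈ F : Q ∈ S_{ω_δ}}`, `Y = {Q ∈ F : Q ∈ e^{iα}·S_{ω'_δ}}`, `2^{|F|}` atoms);
  `jointCrossingLaws_of_finiteQuads` — (F) ⟹ (J) (coupling inequality);
* `dkkmo_theorem_1_2_schrammSmirnov_iff_jointCrossingLaws_of_lemma_5_1` — granted the named fact
  `SchrammSmirnov2011_lemma_5_1`, **DKKMO's configuration-level `d_SS` coupling statement is
  equivalent to (J)**, i.e. to the asymptotic rotation invariance, uniform in `α ∈ (ε, π - ε)`, of
  all joint crossing probabilities of finitely many quads — the multi-quad form of DKKMO's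
  Corollary 1.3 (the tree's per-quad `dkkmo_crossing_rotation_invariance` is its one-quad case).

No definition and no named fact is introduced; the fact itself is not discharged here (its printed
proof needs DKKMO's Theorems 2.2–2.3).

## References

* [DKKMO2020Rotational] arXiv:2012.11672v1: Thm. 1.2, Cor. 1.3, §7.1 pp. 42–43.
* [SchrammSmirnov2011] Ann. Probab. 39 (2011): §1.3, Lemma 5.1.
-/

noncomputable section

open Set Filter
open _root_.MeasureTheory _root_.Topology _root_.ProbabilityTheory
open scoped ENNReal symmDiff
open Literature.Probability.LatticeModels

namespace Literature.Probability.Percolation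

/-! ### A coupling of two finite-range random variables with small disagreement probability -/

section Coupling

variable {Ω Ω' ι : Type*} [MeasurableSpace Ω] [MeasurableSpace Ω']

/-- Law of total probability over the fibres of a map with values in a finite set `s`:
`Σ_{a ∈ s} μ(X = a) · μ[·| X = a] = μ`. [folklore] -/
theorem sum_meas_smul_cond_fiber_of_forall_mem (μ : Measure Ω) [IsFiniteMeasure μ] (s : Finset ι)
    (X : Ω → ι) (hX : ∀ a, MeasurableSet (X ⁻¹' {a})) (hXs : ∀ ω, X ω ∈ s) :
    ∑ a ∈ s, μ (X ⁻¹' {a}) • μ[|X ⁻¹' {a}] = μ := by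
  ext E hE
  simp only [Measure.coe_finsetSum, Measure.coe_smul, Finset.sum_apply, Pi.smul_apply,
    smul_eq_mul]
  have hdisj : Set.PairwiseDisjoint (↑s : Set ι) (fun a => X ⁻¹' {a} ∩ E) :=
    fun a _ b _ hab => disjoint_left.2 fun ω ha hb => hab ((mem_singleton_iff.mp ha.1).symm.trans
      (mem_singleton_iff.mp hb.1))
  calc ∑ a ∈ s, μ (X ⁻¹' {a}) * μ[|X ⁻¹' {a}] E
      = ∑ a ∈ s, μ (X ⁻¹' {a} ∩ E) := Finset.sum_congr rfl fun a _ => by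
          rw [mul_comm, cond_mul_eq_inter (hX a)]
    _ = μ (⋃ a ∈ s, X ⁻¹' {a} ∩ E) :=
          (measure_biUnion_finset hdisj fun a _ => (hX a).inter hE).symm
    _ = μ E := by
          congr 1
          ext ω
          simp only [mem_iUnion, mem_inter_iff, mem_preimage, mem_singleton_iff, exists_prop]
          exact ⟨fun ⟨_, _, _, h⟩ => h, fun h => ⟨X ω, hXs ω, rfl, h⟩⟩

/-- `Measure.map` of a finite sum of measures along a measurable map. [folklore] -/
theorem map_finset_sum_measure {β : Type*} [MeasurableSpace β] {κ : Type*} (s : Finset κ)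
    (ν : κ → Measure Ω) {f : Ω → β} (hf : Measurable f) :
    (∑ k ∈ s, ν k).map f = ∑ k ∈ s, (ν k).map f := by
  induction s using Finset.cons_induction with
  | empty => simp
  | cons a s ha ih => rw [Finset.sum_cons, Finset.sum_cons, Measure.map_add _ _ hf, ih]

/-- **Coupling two finite-range random variables.**  Let `μ`, `μ'` be probability measures and
`X : Ω → ι`, `Y : Ω' → ι` maps with measurable fibres and values in a finite set `s`.  Then there
is a coupling `P` of `μ` and `μ'` (a measure on `Ω × Ω'` with these marginals) with
`P[X ∘ fst ≠ Y ∘ snd] ≤ Σ_{a ∈ s} |μ(X = a) - μ'(Y = a)|`.  Construction: with `p_a = μ(X = a)`,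
`q_a = μ'(Y = a)`, `m_a = min(p_a, q_a)`, `r = Σ (p_a - m_a) = Σ (q_a - m_a)`, put
`w(a,b) = m_a 𝟙_{a=b} + (p_a - m_a)(q_b - m_b)/r` (row sums `p_a`, column sums `q_b`,
off-diagonal mass `≤ r ≤ Σ |p_a - q_a|`) and `P = Σ_{a,b} w(a,b) · μ[·|X=a] ⊗ μ'[·|Y=b]`.
[folklore] -/
theorem exists_coupling_of_finite_range [DecidableEq ι] (μ : Measure Ω) (μ' : Measure Ω')
    [IsProbabilityMeasure μ] [IsProbabilityMeasure μ'] (s : Finset ι) (X : Ω → ι) (Y : Ω' → ι)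
    (hX : ∀ a, MeasurableSet (X ⁻¹' {a})) (hY : ∀ a, MeasurableSet (Y ⁻¹' {a}))
    (hXs : ∀ ω, X ω ∈ s) (hYs : ∀ ω, Y ω ∈ s) :
    ∃ P : Measure (Ω × Ω'), P.map Prod.fst = μ ∧ P.map Prod.snd = μ' ∧
      P {p | X p.1 ≠ Y p.2} ≤
        ENNReal.ofReal (∑ a ∈ s, |μ.real (X ⁻¹' {a}) - μ'.real (Y ⁻¹' {a})|) := by
  -- the weights
  set p : ι → ℝ := fun a => μ.real (X ⁻¹' {a}) with hp
  set q : ι → ℝ := fun a => μ'.real (Y ⁻¹' {a}) with hq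
  set m : ι → ℝ := fun a => min (p a) (q a) with hm
  set r : ℝ := ∑ a ∈ s, (p a - m a) with hr
  have hp0 : ∀ a, 0 ≤ p a := fun a => measureReal_nonneg
  have hq0 : ∀ a, 0 ≤ q a := fun a => measureReal_nonneg
  have hmp : ∀ a, m a ≤ p a := fun a => min_le_left _ _
  have hmq : ∀ a, m a ≤ q a := fun a => min_le_right _ _
  have hm0 : ∀ a, 0 ≤ m a := fun a => le_min (hp0 a) (hq0 a)
  have hdisjX : Set.PairwiseDisjoint (↑s : Set ι) (fun a => X ⁻¹' {a}) :=
    fun a _ b _ hab => disjoint_left.2 fun ω ha hb =>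
      hab ((mem_singleton_iff.mp ha).symm.trans (mem_singleton_iff.mp hb))
  have hdisjY : Set.PairwiseDisjoint (↑s : Set ι) (fun a => Y ⁻¹' {a}) :=
    fun a _ b _ hab => disjoint_left.2 fun ω ha hb =>
      hab ((mem_singleton_iff.mp ha).symm.trans (mem_singleton_iff.mp hb))
  have hsump : ∑ a ∈ s, p a = 1 := by
    have h1 : ∑ a ∈ s, p a = μ.real (⋃ a ∈ s, X ⁻¹' {a}) :=
      (measureReal_biUnion_finset hdisjX fun a _ => hX a).symm
    have h2 : (⋃ a ∈ s, X ⁻¹' {a}) = univ :=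
      eq_univ_of_forall fun ω => mem_iUnion₂.2 ⟨X ω, hXs ω, rfl⟩
    rw [h1, h2, probReal_univ]
  have hsumq : ∑ a ∈ s, q a = 1 := by
    have h1 : ∑ a ∈ s, q a = μ'.real (⋃ a ∈ s, Y ⁻¹' {a}) :=
      (measureReal_biUnion_finset hdisjY fun a _ => hY a).symm
    have h2 : (⋃ a ∈ s, Y ⁻¹' {a}) = univ :=
      eq_univ_of_forall fun ω => mem_iUnion₂.2 ⟨Y ω, hYs ω, rfl⟩
    rw [h1, h2, probReal_univ]
  have hr0 : 0 ≤ r := Finset.sum_nonneg fun a _ => sub_nonneg.2 (hmp a)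
  have hrq : ∑ a ∈ s, (q a - m a) = r := by
    rw [hr, Finset.sum_sub_distrib, Finset.sum_sub_distrib, hsump, hsumq]
  -- if `r = 0` then `p = m = q` on `s`
  have hpm_of_r : r = 0 → ∀ a ∈ s, p a - m a = 0 := fun h0 =>
    (Finset.sum_eq_zero_iff_of_nonneg fun a _ => sub_nonneg.2 (hmp a)).1 h0
  have hqm_of_r : r = 0 → ∀ a ∈ s, q a - m a = 0 := fun h0 =>
    (Finset.sum_eq_zero_iff_of_nonneg fun a _ => sub_nonneg.2 (hmq a)).1 (hrq.trans h0)
  set w : ι → ι → ℝ := fun a b => (if a = b then m a else 0) + (p a - m a) * ((q b - m b) / r)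
    with hw
  have hw0 : ∀ a b, 0 ≤ w a b := fun a b =>
    add_nonneg (by split_ifs; exacts [hm0 a, le_rfl])
      (mul_nonneg (sub_nonneg.2 (hmp a)) (div_nonneg (sub_nonneg.2 (hmq b)) hr0))
  -- row and column sums
  have hrow : ∀ a ∈ s, ∑ b ∈ s, w a b = p a := by
    intro a ha
    simp only [hw, Finset.sum_add_distrib, Finset.sum_ite_eq, if_pos ha]
    rw [← Finset.mul_sum, ← Finset.sum_div, hrq]
    rcases eq_or_ne r 0 with h0 | h0
    · rw [h0, div_zero, mul_zero, add_zero]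
      linarith [hpm_of_r h0 a ha]
    · rw [div_self h0, mul_one]; ring
  have hcol : ∀ b ∈ s, ∑ a ∈ s, w a b = q b := by
    intro b hb
    simp only [hw, Finset.sum_add_distrib, Finset.sum_ite_eq', if_pos hb]
    rw [← Finset.sum_mul]
    change m b + r * ((q b - m b) / r) = q b
    rcases eq_or_ne r 0 with h0 | h0
    · rw [h0, zero_mul, add_zero]
      linarith [hqm_of_r h0 b hb]
    · rw [mul_div_cancel₀ _ h0]; ring
  -- the off-diagonal mass
  have hoff : ∑ a ∈ s, ∑ b ∈ s, (if a = b then 0 else w a b) ≤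
      ∑ a ∈ s, |p a - q a| := by
    have h1 : ∀ a b, (if a = b then 0 else w a b) ≤ (p a - m a) * ((q b - m b) / r) := by
      intro a b
      split_ifs with hab
      · exact mul_nonneg (sub_nonneg.2 (hmp a)) (div_nonneg (sub_nonneg.2 (hmq b)) hr0)
      · simp only [hw, if_neg hab, zero_add]; exact le_rfl
    calc ∑ a ∈ s, ∑ b ∈ s, (if a = b then 0 else w a b)
        ≤ ∑ a ∈ s, ∑ b ∈ s, (p a - m a) * ((q b - m b) / r) :=
          Finset.sum_le_sum fun a _ => Finset.sum_le_sum fun b _ => h1 a b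
      _ = r * (r / r) := by
          simp_rw [← Finset.mul_sum]
          rw [← Finset.sum_mul, ← Finset.sum_div, hrq, ← hr]
      _ ≤ r := by
          rcases eq_or_ne r 0 with h0 | h0
          · rw [h0, zero_mul]
          · rw [div_self h0, mul_one]
      _ ≤ ∑ a ∈ s, |p a - q a| := Finset.sum_le_sum fun a _ => by
          show p a - min (p a) (q a) ≤ |p a - q a|
          rcases le_total (p a) (q a) with h | h
          · rw [min_eq_left h, sub_self]; exact abs_nonneg _
          · rw [min_eq_right h]; exact le_abs_self _
  -- the coupling
  set μa : ι → Measure Ω := fun a => μ[|X ⁻¹' {a}] with hμa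
  set μb : ι → Measure Ω' := fun b => μ'[|Y ⁻¹' {b}] with hμb
  refine ⟨∑ a ∈ s, ∑ b ∈ s, ENNReal.ofReal (w a b) • ((μa a).prod (μb b)), ?_, ?_, ?_⟩
  · -- first marginal
    have hterm : ∀ a b, (ENNReal.ofReal (w a b) • ((μa a).prod (μb b))).map Prod.fst =
        ENNReal.ofReal (w a b) • μa a := by
      intro a b
      rw [Measure.map_smul, Measure.map_fst_prod]
      rcases eq_or_ne (μ' (Y ⁻¹' {b})) 0 with h0 | h0
      · have hqb : q b = 0 := by simp only [hq, measureReal_def, h0, ENNReal.toReal_zero]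
        have hmb : m b = 0 := le_antisymm (hqb ▸ hmq b) (hm0 b)
        have hwab : w a b = 0 := by
          simp only [hw, hqb, hmb, sub_self, zero_div, mul_zero, add_zero]
          split_ifs with hab
          · subst hab; exact hmb
          · rfl
        rw [hwab, ENNReal.ofReal_zero, zero_smul, zero_smul]
      · haveI : IsProbabilityMeasure (μb b) := cond_isProbabilityMeasure h0
        rw [measure_univ, one_smul]
    rw [map_finset_sum_measure _ _ measurable_fst]
    simp_rw [map_finset_sum_measure _ _ measurable_fst, hterm, ← Finset.sum_smul]
    calc ∑ a ∈ s, (∑ b ∈ s, ENNReal.ofReal (w a b)) • μa a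
        = ∑ a ∈ s, μ (X ⁻¹' {a}) • μa a := Finset.sum_congr rfl fun a ha => by
            rw [← ENNReal.ofReal_sum_of_nonneg fun b _ => hw0 a b, hrow a ha,
              ofReal_measureReal (measure_ne_top _ _)]
      _ = μ := sum_meas_smul_cond_fiber_of_forall_mem μ s X hX hXs
  · -- second marginal
    have hterm : ∀ a b, (ENNReal.ofReal (w a b) • ((μa a).prod (μb b))).map Prod.snd =
        ENNReal.ofReal (w a b) • μb b := by
      intro a b
      rw [Measure.map_smul, Measure.map_snd_prod]
      rcases eq_or_ne (μ (X ⁻¹' {a})) 0 with h0 | h0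
      · have hpa : p a = 0 := by simp only [hp, measureReal_def, h0, ENNReal.toReal_zero]
        have hma : m a = 0 := le_antisymm (hpa ▸ hmp a) (hm0 a)
        have hwab : w a b = 0 := by
          simp only [hw, hpa, hma, sub_self, zero_mul, add_zero]
          split_ifs with hab
          · rfl
          · rfl
        rw [hwab, ENNReal.ofReal_zero, zero_smul, zero_smul]
      · haveI : IsProbabilityMeasure (μa a) := cond_isProbabilityMeasure h0
        rw [measure_univ, one_smul]
    rw [map_finset_sum_measure _ _ measurable_snd]
    simp_rw [map_finset_sum_measure _ _ measurable_snd, hterm]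
    rw [Finset.sum_comm]
    simp_rw [← Finset.sum_smul]
    calc ∑ b ∈ s, (∑ a ∈ s, ENNReal.ofReal (w a b)) • μb b
        = ∑ b ∈ s, μ' (Y ⁻¹' {b}) • μb b := Finset.sum_congr rfl fun b hb => by
            rw [← ENNReal.ofReal_sum_of_nonneg fun a _ => hw0 a b, hcol b hb,
              ofReal_measureReal (measure_ne_top _ _)]
      _ = μ' := sum_meas_smul_cond_fiber_of_forall_mem μ' s Y hY hYs
  · -- the disagreement probability
    have hdiag : ∀ a, ((μa a).prod (μb a)) {p : Ω × Ω' | X p.1 ≠ Y p.2} = 0 := by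
      intro a
      refine nonpos_iff_eq_zero.1 ?_
      have hsub : {p : Ω × Ω' | X p.1 ≠ Y p.2} ⊆
          (X ⁻¹' {a})ᶜ ×ˢ (univ : Set Ω') ∪ (univ : Set Ω) ×ˢ (Y ⁻¹' {a})ᶜ := by
        intro x hx
        by_cases h1 : X x.1 = a
        · refine Or.inr ⟨mem_univ _, fun h2 => hx ?_⟩
          exact h1.trans (mem_singleton_iff.mp h2).symm
        · exact Or.inl ⟨h1, mem_univ _⟩
      have hXc : μa a (X ⁻¹' {a})ᶜ = 0 := by
        simp only [hμa]
        rw [cond_apply (hX a), inter_compl_self, measure_empty, mul_zero]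
      have hYc : μb a (Y ⁻¹' {a})ᶜ = 0 := by
        simp only [hμb]
        rw [cond_apply (hY a), inter_compl_self, measure_empty, mul_zero]
      calc ((μa a).prod (μb a)) {p : Ω × Ω' | X p.1 ≠ Y p.2}
          ≤ ((μa a).prod (μb a)) ((X ⁻¹' {a})ᶜ ×ˢ (univ : Set Ω') ∪ univ ×ˢ (Y ⁻¹' {a})ᶜ) :=
            measure_mono hsub
        _ ≤ ((μa a).prod (μb a)) ((X ⁻¹' {a})ᶜ ×ˢ (univ : Set Ω')) +
              ((μa a).prod (μb a)) (univ ×ˢ (Y ⁻¹' {a})ᶜ) := measure_union_le _ _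
        _ = 0 := by rw [Measure.prod_prod, Measure.prod_prod, hXc, hYc, zero_mul, mul_zero,
            add_zero]
    have hterm : ∀ a b, ENNReal.ofReal (w a b) * ((μa a).prod (μb b)) {p : Ω × Ω' | X p.1 ≠ Y p.2} ≤
        ENNReal.ofReal (if a = b then 0 else w a b) := by
      intro a b
      split_ifs with hab
      · subst hab; rw [hdiag, mul_zero]; exact bot_le
      · calc ENNReal.ofReal (w a b) * ((μa a).prod (μb b)) {p : Ω × Ω' | X p.1 ≠ Y p.2}
            ≤ ENNReal.ofReal (w a b) * 1 := by
              gcongr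
              calc ((μa a).prod (μb b)) {p : Ω × Ω' | X p.1 ≠ Y p.2}
                  ≤ ((μa a).prod (μb b)) univ := measure_mono (subset_univ _)
                _ = μa a univ * μb b univ := by rw [← univ_prod_univ, Measure.prod_prod]
                _ ≤ 1 * 1 := mul_le_mul' prob_le_one prob_le_one
                _ = 1 := one_mul 1
          _ = ENNReal.ofReal (w a b) := mul_one _
    simp only [Measure.coe_finsetSum, Measure.coe_smul, Finset.sum_apply, Pi.smul_apply,
      smul_eq_mul]
    calc ∑ a ∈ s, ∑ b ∈ s, ENNReal.ofReal (w a b) * ((μa a).prod (μb b)) {p | X p.1 ≠ Y p.2}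
        ≤ ∑ a ∈ s, ∑ b ∈ s, ENNReal.ofReal (if a = b then 0 else w a b) :=
          Finset.sum_le_sum fun a _ => Finset.sum_le_sum fun b _ => hterm a b
      _ = ENNReal.ofReal (∑ a ∈ s, ∑ b ∈ s, (if a = b then 0 else w a b)) := by
          rw [ENNReal.ofReal_sum_of_nonneg fun a _ => Finset.sum_nonneg fun b _ => ?_]
          · exact Finset.sum_congr rfl fun a _ =>
              (ENNReal.ofReal_sum_of_nonneg fun b _ => by split_ifs; exacts [le_rfl, hw0 a b]).symm
          · split_ifs; exacts [le_rfl, hw0 a b]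
      _ ≤ ENNReal.ofReal (∑ a ∈ s, |p a - q a|) := ENNReal.ofReal_le_ofReal hoff

end Coupling

/-! ### Crossing patterns of finitely many quads -/

section Patterns

open QuadCrossing

/-- `F.filter p = G` for `G ⊆ F` means: on `F`, `p` is the indicator of `G`. [folklore] -/
theorem finset_filter_eq_iff_of_subset {β : Type*} {F G : Finset β} (p : β → Prop)
    [DecidablePred p] (hG : G ⊆ F) : F.filter p = G ↔ ∀ a ∈ F, p a ↔ a ∈ G := by
  constructor
  · intro h a ha
    rw [← h, Finset.mem_filter]
    exact ⟨fun hp => ⟨ha, hp⟩, fun h' => h'.2⟩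
  · intro h
    ext a
    rw [Finset.mem_filter]
    exact ⟨fun h' => (h a h'.1).1 h'.2, fun haG => ⟨hG haG, (h a (hG haG)).2 haG⟩⟩

/-- `F.filter p` is a subset of `F`, so it is never a non-subset `G`. [folklore] -/
theorem finset_filter_ne_of_not_subset {β : Type*} {F G : Finset β} (p : β → Prop)
    [DecidablePred p] (hG : ¬ G ⊆ F) : F.filter p ≠ G :=
  fun h => hG (h ▸ Finset.filter_subset p F)

/-- The atom events of the crossing field of a finite family `F` — "the quads of `F` lying in the
configuration `f ω` are exactly those of `G`" — are measurable for a measurable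
`f : Ω → ℋ_ℂ` (crossing events `⊞_Q` are closed). [cite: SchrammSmirnov2011, §1.3] -/
theorem measurableSet_setOf_forall_mem_iff {X : Type*} [MeasurableSpace X]
    (F G : Finset (Quad (univ : Set ℂ))) {f : X → QuadConfig (univ : Set ℂ)} (hf : Measurable f) :
    MeasurableSet {ω | ∀ Q ∈ F, Q ∈ f ω ↔ Q ∈ G} := by
  have hset : {ω | ∀ Q ∈ F, Q ∈ f ω ↔ Q ∈ G} = ⋂ Q ∈ F, {ω | Q ∈ f ω ↔ Q ∈ G} := by
    ext ω; simp only [mem_setOf_eq, mem_iInter]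
  rw [hset]
  refine Finset.measurableSet_biInter F fun Q _ => ?_
  by_cases hQ : Q ∈ G
  · simp only [hQ, iff_true]
    exact hf (QuadConfig.isClosed_crossedEvent Q).measurableSet
  · simp only [hQ, iff_false]
    exact (hf (QuadConfig.isClosed_crossedEvent Q).measurableSet).compl

/-- **(J) ⟹ (F): couplings agreeing on finitely many quads from the closeness of the
finite-dimensional crossing laws.**  If for every finite family `F` of quads and `ε > 0` the joint
laws of the crossing indicators of `F` in `S_{ω_δ}` and in `e^{iα}·S_{ω_δ}` are `ε`-close atom by
atom for `α ∈ (ε, π - ε)` and small meshes, then (apply `exists_coupling_of_finite_range` to the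
crossing patterns `{Q ∈ F : Q ∈ S_{ω_δ}}`, `{Q ∈ F : Q ∈ e^{iα}·S_{ω'_δ}}` ranging over the `2^{|F|}`
subsets of `F`, with the hypothesis at `ε / 2^{|F|+1}`) some coupling of `P_{1/2}` with itself makes
all these indicators agree outside an event of probability `< ε`.
[cite: DKKMO2020Rotational, Thm. 1.2 (d_SS part), Cor. 1.3] -/
theorem finiteQuads_of_jointCrossingLaws
    (hJ : ∀ ε : ℝ, 0 < ε → ∀ F : Finset (Quad (univ : Set ℂ)),
      ∃ δ₀ : ℝ, 0 < δ₀ ∧ ∀ α ∈ Set.Ioo ε (Real.pi - ε), ∀ δ : ℝ, 0 < δ → δ ≤ δ₀ →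
        ∀ G, G ⊆ F →
          |(bondPercolation (zdGraph 2) half).real
              {ω | ∀ Q ∈ F, Q ∈ z2QuadConfig univ δ ω ↔ Q ∈ G} -
            (bondPercolation (zdGraph 2) half).real
              {ω | ∀ Q ∈ F, Q ∈ QuadConfig.rotate α (z2QuadConfig univ δ ω) ↔ Q ∈ G}| ≤ ε) :
    ∀ ε : ℝ, 0 < ε → ∀ F : Finset (Quad (univ : Set ℂ)),
      ∃ δ₀ : ℝ, 0 < δ₀ ∧ ∀ α ∈ Set.Ioo ε (Real.pi - ε), ∀ δ : ℝ, 0 < δ → δ ≤ δ₀ →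
        ∃ P : Measure (BondConfig (Site 2) × BondConfig (Site 2)),
          P.map Prod.fst = bondPercolation (zdGraph 2) half ∧
          P.map Prod.snd = bondPercolation (zdGraph 2) half ∧
          P {p | ∃ Q ∈ F, ¬ (Q ∈ z2QuadConfig univ δ p.1 ↔
            Q ∈ QuadConfig.rotate α (z2QuadConfig univ δ p.2))} < ENNReal.ofReal ε := by
  classical
  intro ε hε F
  set n : ℕ := F.powerset.card with hn
  have hn0 : 0 < n := Finset.card_pos.2 ⟨∅, Finset.empty_mem_powerset F⟩
  have hn0' : (0 : ℝ) < n := by exact_mod_cast hn0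
  have hε' : 0 < ε / (2 * n) := by positivity
  obtain ⟨δ₀, hδ₀, hJ'⟩ := hJ (ε / (2 * n)) hε' F
  refine ⟨δ₀, hδ₀, fun α hα δ hδ hδle => ?_⟩
  have hle : ε / (2 * n) ≤ ε := by
    rw [div_le_iff₀ (by positivity)]
    have h1 : (1 : ℝ) ≤ n := by exact_mod_cast hn0
    nlinarith
  have hα' : α ∈ Set.Ioo (ε / (2 * n)) (Real.pi - ε / (2 * n)) :=
    ⟨hle.trans_lt hα.1, hα.2.trans_le (by linarith)⟩
  -- the crossing patterns
  set μ : Measure (BondConfig (Site 2)) := bondPercolation (zdGraph 2) half with hμ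
  set X : BondConfig (Site 2) → Finset (Quad (univ : Set ℂ)) := fun ω =>
    F.filter fun Q => Q ∈ z2QuadConfig univ δ ω with hXdef
  set Y : BondConfig (Site 2) → Finset (Quad (univ : Set ℂ)) := fun ω =>
    F.filter fun Q => Q ∈ QuadConfig.rotate α (z2QuadConfig univ δ ω) with hYdef
  have hmeasS : Measurable (z2QuadConfig (univ : Set ℂ) δ) := measurable_z2QuadConfig isOpen_univ hδ
  have hmeasS' : Measurable fun ω => QuadConfig.rotate α (z2QuadConfig (univ : Set ℂ) δ ω) :=
    (QuadConfig.measurable_rotate α).comp hmeasS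
  -- fibres
  have hXpre : ∀ G, G ⊆ F → X ⁻¹' {G} = {ω | ∀ Q ∈ F, Q ∈ z2QuadConfig univ δ ω ↔ Q ∈ G} :=
    fun G hG => Set.ext fun ω => finset_filter_eq_iff_of_subset _ hG
  have hYpre : ∀ G, G ⊆ F →
      Y ⁻¹' {G} = {ω | ∀ Q ∈ F, Q ∈ QuadConfig.rotate α (z2QuadConfig univ δ ω) ↔ Q ∈ G} :=
    fun G hG => Set.ext fun ω => finset_filter_eq_iff_of_subset _ hG
  have hXpre' : ∀ G, ¬ G ⊆ F → X ⁻¹' {G} = ∅ := fun G hG =>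
    subset_empty_iff.mp fun ω hω => (finset_filter_ne_of_not_subset _ hG (mem_singleton_iff.mp hω)).elim
  have hYpre' : ∀ G, ¬ G ⊆ F → Y ⁻¹' {G} = ∅ := fun G hG =>
    subset_empty_iff.mp fun ω hω => (finset_filter_ne_of_not_subset _ hG (mem_singleton_iff.mp hω)).elim
  have hXm : ∀ G, MeasurableSet (X ⁻¹' {G}) := fun G => by
    by_cases hG : G ⊆ F
    · rw [hXpre G hG]; exact measurableSet_setOf_forall_mem_iff F G hmeasS
    · rw [hXpre' G hG]; exact MeasurableSet.empty
  have hYm : ∀ G, MeasurableSet (Y ⁻¹' {G}) := fun G => by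
    by_cases hG : G ⊆ F
    · rw [hYpre G hG]; exact measurableSet_setOf_forall_mem_iff F G hmeasS'
    · rw [hYpre' G hG]; exact MeasurableSet.empty
  have hXs : ∀ ω, X ω ∈ F.powerset := fun ω => Finset.mem_powerset.2 (Finset.filter_subset _ _)
  have hYs : ∀ ω, Y ω ∈ F.powerset := fun ω => Finset.mem_powerset.2 (Finset.filter_subset _ _)
  obtain ⟨P, hP1, hP2, hPD⟩ := exists_coupling_of_finite_range μ μ F.powerset X Y hXm hYm hXs hYs
  refine ⟨P, hP1, hP2, ?_⟩
  -- disagreement on a quad of `F` is a disagreement of the patterns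
  have hsub : {p : BondConfig (Site 2) × BondConfig (Site 2) | ∃ Q ∈ F,
      ¬ (Q ∈ z2QuadConfig univ δ p.1 ↔ Q ∈ QuadConfig.rotate α (z2QuadConfig univ δ p.2))} ⊆
      {p | X p.1 ≠ Y p.2} := by
    rintro p ⟨Q, hQF, hQ⟩ heq
    apply hQ
    have h1 : Q ∈ X p.1 ↔ Q ∈ z2QuadConfig univ δ p.1 := by
      rw [hXdef, Finset.mem_filter]; exact ⟨fun h => h.2, fun h => ⟨hQF, h⟩⟩
    have h2 : Q ∈ Y p.2 ↔ Q ∈ QuadConfig.rotate α (z2QuadConfig univ δ p.2) := by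
      rw [hYdef, Finset.mem_filter]; exact ⟨fun h => h.2, fun h => ⟨hQF, h⟩⟩
    rw [← h1, ← h2, heq]
  -- the atoms are close
  have hatoms : ∑ G ∈ F.powerset, |μ.real (X ⁻¹' {G}) - μ.real (Y ⁻¹' {G})| ≤ ε / 2 := by
    calc ∑ G ∈ F.powerset, |μ.real (X ⁻¹' {G}) - μ.real (Y ⁻¹' {G})|
        ≤ ∑ G ∈ F.powerset, ε / (2 * n) := Finset.sum_le_sum fun G hG => by
          rw [hXpre G (Finset.mem_powerset.1 hG), hYpre G (Finset.mem_powerset.1 hG)]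
          exact hJ' α hα' δ hδ hδle G (Finset.mem_powerset.1 hG)
      _ = n * (ε / (2 * n)) := by rw [Finset.sum_const, nsmul_eq_mul]
      _ = ε / 2 := by field_simp
  calc P {p | ∃ Q ∈ F, ¬ (Q ∈ z2QuadConfig univ δ p.1 ↔
          Q ∈ QuadConfig.rotate α (z2QuadConfig univ δ p.2))}
      ≤ P {p | X p.1 ≠ Y p.2} := measure_mono hsub
    _ ≤ ENNReal.ofReal (∑ G ∈ F.powerset, |μ.real (X ⁻¹' {G}) - μ.real (Y ⁻¹' {G})|) := hPD
    _ ≤ ENNReal.ofReal (ε / 2) := ENNReal.ofReal_le_ofReal hatoms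
    _ < ENNReal.ofReal ε := (ENNReal.ofReal_lt_ofReal_iff hε).2 (by linarith)

/-- **(F) ⟹ (J)**: conversely, a coupling under which all crossing indicators of `F` agree outside an
event of probability `< ε` makes every atom of the two joint laws `ε`-close (coupling inequality,
`abs_measureReal_sub_le_of_coupling`). [cite: DKKMO2020Rotational, Cor. 1.3 (proof, §7.1 p. 43)] -/
theorem jointCrossingLaws_of_finiteQuads
    (hF : ∀ ε : ℝ, 0 < ε → ∀ F : Finset (Quad (univ : Set ℂ)),
      ∃ δ₀ : ℝ, 0 < δ₀ ∧ ∀ α ∈ Set.Ioo ε (Real.pi - ε), ∀ δ : ℝ, 0 < δ → δ ≤ δ₀ →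
        ∃ P : Measure (BondConfig (Site 2) × BondConfig (Site 2)),
          P.map Prod.fst = bondPercolation (zdGraph 2) half ∧
          P.map Prod.snd = bondPercolation (zdGraph 2) half ∧
          P {p | ∃ Q ∈ F, ¬ (Q ∈ z2QuadConfig univ δ p.1 ↔
            Q ∈ QuadConfig.rotate α (z2QuadConfig univ δ p.2))} < ENNReal.ofReal ε) :
    ∀ ε : ℝ, 0 < ε → ∀ F : Finset (Quad (univ : Set ℂ)),
      ∃ δ₀ : ℝ, 0 < δ₀ ∧ ∀ α ∈ Set.Ioo ε (Real.pi - ε), ∀ δ : ℝ, 0 < δ → δ ≤ δ₀ →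
        ∀ G, G ⊆ F →
          |(bondPercolation (zdGraph 2) half).real
              {ω | ∀ Q ∈ F, Q ∈ z2QuadConfig univ δ ω ↔ Q ∈ G} -
            (bondPercolation (zdGraph 2) half).real
              {ω | ∀ Q ∈ F, Q ∈ QuadConfig.rotate α (z2QuadConfig univ δ ω) ↔ Q ∈ G}| ≤ ε := by
  intro ε hε F
  obtain ⟨δ₀, hδ₀, h⟩ := hF ε hε F
  refine ⟨δ₀, hδ₀, fun α hα δ hδ hδle G _ => ?_⟩
  obtain ⟨P, hP1, hP2, hPD⟩ := h α hα δ hδ hδle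
  haveI : IsProbabilityMeasure P := isProbabilityMeasure_of_map_fst hP1
  have hmeasS : Measurable (z2QuadConfig (univ : Set ℂ) δ) := measurable_z2QuadConfig isOpen_univ hδ
  have hA : MeasurableSet {ω | ∀ Q ∈ F, Q ∈ z2QuadConfig univ δ ω ↔ Q ∈ G} :=
    measurableSet_setOf_forall_mem_iff F G hmeasS
  have hB : MeasurableSet {ω | ∀ Q ∈ F, Q ∈ QuadConfig.rotate α (z2QuadConfig univ δ ω) ↔ Q ∈ G} :=
    measurableSet_setOf_forall_mem_iff F G ((QuadConfig.measurable_rotate α).comp hmeasS)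
  refine (abs_measureReal_sub_le_of_coupling P hP1 hP2 hA hB).trans ?_
  have hsub : (Prod.fst ⁻¹' {ω | ∀ Q ∈ F, Q ∈ z2QuadConfig univ δ ω ↔ Q ∈ G}) ∆
      (Prod.snd ⁻¹' {ω | ∀ Q ∈ F, Q ∈ QuadConfig.rotate α (z2QuadConfig univ δ ω) ↔ Q ∈ G}) ⊆
      {p : BondConfig (Site 2) × BondConfig (Site 2) | ∃ Q ∈ F,
        ¬ (Q ∈ z2QuadConfig univ δ p.1 ↔ Q ∈ QuadConfig.rotate α (z2QuadConfig univ δ p.2))} := by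
    intro p hp
    by_contra hcon
    have hagree : ∀ Q ∈ F,
        (Q ∈ z2QuadConfig univ δ p.1 ↔ Q ∈ QuadConfig.rotate α (z2QuadConfig univ δ p.2)) :=
      fun Q hQ => by by_contra h'; exact hcon ⟨Q, hQ, h'⟩
    have hiff : p ∈ Prod.fst ⁻¹' {ω | ∀ Q ∈ F, Q ∈ z2QuadConfig univ δ ω ↔ Q ∈ G} ↔
        p ∈ Prod.snd ⁻¹' {ω | ∀ Q ∈ F, Q ∈ QuadConfig.rotate α (z2QuadConfig univ δ ω) ↔ Q ∈ G} :=
      ⟨fun h1 Q hQ => (hagree Q hQ).symm.trans (h1 Q hQ),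
        fun h2 Q hQ => (hagree Q hQ).trans (h2 Q hQ)⟩
    rcases (mem_symmDiff.1 hp) with ⟨h1, h2⟩ | ⟨h2, h1⟩
    · exact h2 (hiff.1 h1)
    · exact h1 (hiff.2 h2)
  exact (measureReal_mono hsub).trans (ENNReal.toReal_lt_of_lt_ofReal hPD).le

/-- **(F) ⟺ (J).** [cite: DKKMO2020Rotational, Thm. 1.2 (d_SS part), Cor. 1.3] -/
theorem finiteQuads_iff_jointCrossingLaws :
    (∀ ε : ℝ, 0 < ε → ∀ F : Finset (Quad (univ : Set ℂ)),
      ∃ δ₀ : ℝ, 0 < δ₀ ∧ ∀ α ∈ Set.Ioo ε (Real.pi - ε), ∀ δ : ℝ, 0 < δ → δ ≤ δ₀ →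
        ∃ P : Measure (BondConfig (Site 2) × BondConfig (Site 2)),
          P.map Prod.fst = bondPercolation (zdGraph 2) half ∧
          P.map Prod.snd = bondPercolation (zdGraph 2) half ∧
          P {p | ∃ Q ∈ F, ¬ (Q ∈ z2QuadConfig univ δ p.1 ↔
            Q ∈ QuadConfig.rotate α (z2QuadConfig univ δ p.2))} < ENNReal.ofReal ε) ↔
    ∀ ε : ℝ, 0 < ε → ∀ F : Finset (Quad (univ : Set ℂ)),
      ∃ δ₀ : ℝ, 0 < δ₀ ∧ ∀ α ∈ Set.Ioo ε (Real.pi - ε), ∀ δ : ℝ, 0 < δ → δ ≤ δ₀ →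
        ∀ G, G ⊆ F →
          |(bondPercolation (zdGraph 2) half).real
              {ω | ∀ Q ∈ F, Q ∈ z2QuadConfig univ δ ω ↔ Q ∈ G} -
            (bondPercolation (zdGraph 2) half).real
              {ω | ∀ Q ∈ F, Q ∈ QuadConfig.rotate α (z2QuadConfig univ δ ω) ↔ Q ∈ G}| ≤ ε :=
  ⟨jointCrossingLaws_of_finiteQuads, finiteQuads_of_jointCrossingLaws⟩

/-! ### The fact and the finite-dimensional crossing laws -/

/-- **Granted Schramm–Smirnov's (5.1), `dkkmo_theorem_1_2_schrammSmirnov` is equivalent to (J)**, the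
asymptotic rotation invariance, uniform in `α ∈ (ε, π - ε)`, of the finite-dimensional laws of the
crossing field. [cite: DKKMO2020Rotational, Thm. 1.2 (d_SS part), Cor. 1.3, §7.1 pp. 42–43] -/
theorem dkkmo_theorem_1_2_schrammSmirnov_iff_jointCrossingLaws_of_continuity
    (hcont : ∀ (Q₀ : Quad (univ : Set ℂ)) (ε : ℝ≥0∞), 0 < ε →
      ∃ Q' Q'' : Quad (univ : Set ℂ), Quad.StrictlyDominated Q' Q₀ ∧ Quad.StrictlyDominated Q₀ Q'' ∧
        ∃ δ₀ : ℝ, 0 < δ₀ ∧ ∀ δ : ℝ, 0 < δ → δ < δ₀ →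
          bondPercolation (zdGraph 2) half
            {ω | (∃ K, Q'.IsCrossing K ∧ K ⊆ openEdgeUnion δ ω) ∧
              ¬ ∃ K, Q''.IsCrossing K ∧ K ⊆ openEdgeUnion δ ω} ≤ ε) :
    dkkmo_theorem_1_2_schrammSmirnov ↔
      ∀ ε : ℝ, 0 < ε → ∀ F : Finset (Quad (univ : Set ℂ)),
        ∃ δ₀ : ℝ, 0 < δ₀ ∧ ∀ α ∈ Set.Ioo ε (Real.pi - ε), ∀ δ : ℝ, 0 < δ → δ ≤ δ₀ →
          ∀ G, G ⊆ F →
            |(bondPercolation (zdGraph 2) half).real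
                {ω | ∀ Q ∈ F, Q ∈ z2QuadConfig univ δ ω ↔ Q ∈ G} -
              (bondPercolation (zdGraph 2) half).real
                {ω | ∀ Q ∈ F, Q ∈ QuadConfig.rotate α (z2QuadConfig univ δ ω) ↔ Q ∈ G}| ≤ ε :=
  (dkkmo_theorem_1_2_schrammSmirnov_iff_finiteQuads_of_continuity hcont).trans
    finiteQuads_iff_jointCrossingLaws

/-- **Granted the named fact `SchrammSmirnov2011_lemma_5_1`, `dkkmo_theorem_1_2_schrammSmirnov` is
equivalent to (J)**: for every finite family `F` of quads and `ε > 0` there is `δ₀ > 0` such that for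
`α ∈ (ε, π - ε)`, `0 < δ ≤ δ₀` and every `G ⊆ F`,
`|P_{1/2}[the quads of F crossed on δℤ² are exactly those of G] - P_{1/2}[the same on e^{iα}δℤ²]| ≤ ε`
— the multi-quad, configuration-free form of DKKMO's Corollary 1.3.
[cite: DKKMO2020Rotational, Thm. 1.2 (d_SS part), Cor. 1.3, §7.1 pp. 42–43] -/
theorem dkkmo_theorem_1_2_schrammSmirnov_iff_jointCrossingLaws_of_lemma_5_1
    (h51 : SchrammSmirnov2011_lemma_5_1) :
    dkkmo_theorem_1_2_schrammSmirnov ↔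
      ∀ ε : ℝ, 0 < ε → ∀ F : Finset (Quad (univ : Set ℂ)),
        ∃ δ₀ : ℝ, 0 < δ₀ ∧ ∀ α ∈ Set.Ioo ε (Real.pi - ε), ∀ δ : ℝ, 0 < δ → δ ≤ δ₀ →
          ∀ G, G ⊆ F →
            |(bondPercolation (zdGraph 2) half).real
                {ω | ∀ Q ∈ F, Q ∈ z2QuadConfig univ δ ω ↔ Q ∈ G} -
              (bondPercolation (zdGraph 2) half).real
                {ω | ∀ Q ∈ F, Q ∈ QuadConfig.rotate α (z2QuadConfig univ δ ω) ↔ Q ∈ G}| ≤ ε :=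
  (dkkmo_theorem_1_2_schrammSmirnov_iff_finiteQuads_of_lemma_5_1 h51).trans
    finiteQuads_iff_jointCrossingLaws

/-- **The fact from (J) and Lemma 5.1** (the direction a future proof would use).
[cite: DKKMO2020Rotational, Thm. 1.2 (d_SS part), §7.1 pp. 42–43] -/
theorem dkkmo_theorem_1_2_schrammSmirnov_of_jointCrossingLaws_of_lemma_5_1
    (h51 : SchrammSmirnov2011_lemma_5_1)
    (hJ : ∀ ε : ℝ, 0 < ε → ∀ F : Finset (Quad (univ : Set ℂ)),
      ∃ δ₀ : ℝ, 0 < δ₀ ∧ ∀ α ∈ Set.Ioo ε (Real.pi - ε), ∀ δ : ℝ, 0 < δ → δ ≤ δ₀ →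
        ∀ G, G ⊆ F →
          |(bondPercolation (zdGraph 2) half).real
              {ω | ∀ Q ∈ F, Q ∈ z2QuadConfig univ δ ω ↔ Q ∈ G} -
            (bondPercolation (zdGraph 2) half).real
              {ω | ∀ Q ∈ F, Q ∈ QuadConfig.rotate α (z2QuadConfig univ δ ω) ↔ Q ∈ G}| ≤ ε) :
    dkkmo_theorem_1_2_schrammSmirnov :=
  (dkkmo_theorem_1_2_schrammSmirnov_iff_jointCrossingLaws_of_lemma_5_1 h51).2 hJ

/-- **The multi-quad Corollary 1.3 from the fact and Lemma 5.1**: DKKMO's `d_SS` coupling theorem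
gives the asymptotic rotation invariance of all joint crossing probabilities of finitely many quads
("the result follows directly from Theorem 1.2 and the measurability of `𝒞(Q)` in the
Schramm–Smirnov topology", §7.1 p. 43 — the boundary of `𝒞(Q)` being negligible by Lemma 5.1).
[cite: DKKMO2020Rotational, Cor. 1.3 (q = 1), proof §7.1 p. 43] -/
theorem jointCrossingLaws_of_dkkmo_theorem_1_2_schrammSmirnov_of_lemma_5_1
    (h51 : SchrammSmirnov2011_lemma_5_1) (h : dkkmo_theorem_1_2_schrammSmirnov) :
    ∀ ε : ℝ, 0 < ε → ∀ F : Finset (Quad (univ : Set ℂ)),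
      ∃ δ₀ : ℝ, 0 < δ₀ ∧ ∀ α ∈ Set.Ioo ε (Real.pi - ε), ∀ δ : ℝ, 0 < δ → δ ≤ δ₀ →
        ∀ G, G ⊆ F →
          |(bondPercolation (zdGraph 2) half).real
              {ω | ∀ Q ∈ F, Q ∈ z2QuadConfig univ δ ω ↔ Q ∈ G} -
            (bondPercolation (zdGraph 2) half).real
              {ω | ∀ Q ∈ F, Q ∈ QuadConfig.rotate α (z2QuadConfig univ δ ω) ↔ Q ∈ G}| ≤ ε :=
  (dkkmo_theorem_1_2_schrammSmirnov_iff_jointCrossingLaws_of_lemma_5_1 h51).1 h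

end Patterns

end Literature.Probability.Percolation
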